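import Summits.MatrixMultiplication.MatrixMultiplication.Theorems.SoloBlindRelativeKoszul
import Summits.MatrixMultiplication.MatrixMultiplication.Theorems.SoloBlindAbelianRealization
import Literature.Computability.AlgebraicComplexity.BorderRankCWKoszulRanksCubeTwoProofs
import Literature.Computability.AlgebraicComplexity.MatMulRankLowerBoundsBlaserProofs
import Literature.Computability.AlgebraicComplexity.MonomialRestrictionProducts
import Literature.Barriers.MatrixMultiplication.UniversalMethodBarrierDegeneration
import HarnessLib

/-!
# `T_cw,2^{⊠3}` is not a degeneration of eleven copies of `T_cw,2` — a certified rung of the relative door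

Solo-blind seat `solo-MatrixMultiplication-blind`, session s8 (paper.md §17.7).

`SoloBlindRelativeKoszul.lean` bounds every Koszul flattening of a degeneration `X` of `⟨m⟩ ⊠ S` by
`m · B`, `B` a bound for the flattenings of `S` over all extension fields.  Here the crude but formal
`S`-side bound `B = C(q-1, p) · R(S)` (Landsberg–Ottaviani's rank-one count and base change of rank
decompositions) is plugged in, and combined with two facts already in the tree:

* the kernel-certified Koszul rank `265 ≤ rank K_{(5,2)}(T_cw,2^{⊠3})` of CGLV 2022, Thm. 1.2
  (`CGLV2022_koszulRank_cube_two_holds`, an exact LU certificate), and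
* `R(T_cw,2^{⊠N}) ≤ 4^N` (`tensorRank_kroneckerPow_cwTensor_two_le_four_pow`, the Klein-group
  realization of this seat's first session).

Result (`soloKos_cwTwo_cube_not_relDegeneration`): for every `m ≤ 11`, `⟨m⟩ ⊠ T_cw,2^{⊠1} ⋭ T_cw,2^{⊠3}`
over `ℂ` (`11 · 6 · 4 = 264 < 265`); in the notation of the relative door
(`SoloBlindRelativeDegeneration.lean`, `(j, d) = (1, 2)`): an identity `⟨m⟩ ⊠ T ⊵ T^{⊠2} ⊠ T`, which would
give `R̃(T_cw,2)² ≤ m`, needs `m ≥ 12` (`soloKos_cwTwo_relativeDoor_one_two`).  This includes the "tight"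
value `m = 9`, which would have meant `R̃(T_cw,2) = 3`.  (The seat's uncertified modular computations at
`(q, p) = (9, 4)`, `(11, 5)` push the threshold to `m ≥ 14`; they are not used here.)

## References
* A. Conner, F. Gesmundo, J. M. Landsberg, E. Ventura, *Rank and border rank of Kronecker powers of
  tensors and Strassen's laser method*, comput. complexity 31 (2022), Thm. 1.2. [ConnerGesmundoLandsbergVentura2022]
* J. M. Landsberg, G. Ottaviani, Theory of Computing 11 (2015) 285–298, Thm. 2.1. [LandsbergOttaviani2015]
* J. Alman, Theory of Computing 17 (2021), §2.4. [Alman2021]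
-/

open scoped BigOperators Polynomial Matrix
open Matrix

namespace Summit.MatrixMultiplication.MatrixMultiplication.Theorems

open Literature.Computability.AlgebraicComplexity
open Literature.Barriers.MatrixMultiplication

universe u

section General

variable {K : Type u} [Field K]
variable {ι κ μ ι' κ' μ' : Type u} [Fintype ι] [Fintype κ] [Fintype μ] [Fintype ι'] [Fintype κ']
  [Fintype μ']

/-- The crude `S`-side bound over every extension field: `rank K_{M'}(S_L) ≤ C(q-1, p) · R(S)`
(rank-one count, and `R(S_L) ≤ R(S)` by base change of a decomposition). [cite: LandsbergOttaviani2015, Thm 2.1 (proof)] -/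
theorem soloKos_sSide_tensorRank (q p : ℕ) (S : ι → κ → μ → K) (L : Type u) [Field L] [Algebra K L]
    (M' : Matrix (Fin q) ι L) :
    (koszulFlatteningGen q p M'.mulVecLin (fun a b c => algebraMap K L (S a b c))).rank ≤
      (q - 1).choose p * tensorRank S :=
  (rank_koszulFlatteningGen_le_choose_mul_tensorRank q p M'.mulVecLin _).trans
    (Nat.mul_le_mul_left _ (tensorRank_map_le (algebraMap K L) S))

/-- **Relative Koszul bound with the rank of the common factor**: `⟨m⟩ ⊠ S ⊵ X` forces
`rank K_M(X) ≤ m · C(q-1, p) · R(S)` for every `(q, p)`-flattening of `X`. [cite: LandsbergOttaviani2015, Thm 2.1] [cite: Alman2021, §2.4] -/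
theorem soloKos_relativeKoszul_tensorRank (q p : ℕ) (X : ι' → κ' → μ' → K) (S : ι → κ → μ → K)
    (m : ℕ) (h : PolyDegeneratesTo (kroneckerTensor (unitTensor K m) S) X)
    (M : Matrix (Fin q) ι' K) :
    (koszulFlatteningGen q p M.mulVecLin X).rank ≤ m * ((q - 1).choose p * tensorRank S) :=
  soloKos_relativeKoszul q p X S m (fun L _ _ M' => soloKos_sSide_tensorRank q p S L M') h M

end General

/-! ## The cube of `T_cw,2` -/

section CwCube

/-- The tree's certified `(q, p) = (5, 2)` rank, restated for `koszulFlatteningGen 5 2`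
(`= koszulFlattening 2`). [cite: ConnerGesmundoLandsbergVentura2022, Thm. 1.2 (q = 2, cube)] -/
theorem soloKos_cwTwoCube_koszulGen_ge :
    265 ≤ (koszulFlatteningGen 5 2 (cglvPhiCube2 ℂ).mulVecLin (kroneckerPow (cwTensor ℂ 2) 3)).rank := by
  have h := CGLV2022_koszulRank_cube_two_holds
  unfold CGLV2022_koszulRank_cube_two at h
  rw [← koszulFlatteningGen_two_mul_add_one 2] at h
  exact h

/-- **`⟨m⟩ ⊠ T_cw,2 ⋭ T_cw,2^{⊠3}` for `m ≤ 11`** (with `T_cw,2` in its `⊠1` indexing, the format of the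
relative door): the `(5, 2)` flattening of the cube has rank `≥ 265 > 264 = 11 · C(4,2) · 4 ≥
m · C(4,2) · R(T_cw,2^{⊠1})`. [new] -/
theorem soloKos_cwTwo_cube_not_relDegeneration {m : ℕ} (hm : m ≤ 11) :
    ¬ PolyDegeneratesTo (kroneckerTensor (unitTensor ℂ m) (kroneckerPow (cwTensor ℂ 2) 1))
        (kroneckerPow (cwTensor ℂ 2) 3) := by
  intro h
  have hX := soloKos_relativeKoszul_tensorRank 5 2 _ _ m h (cglvPhiCube2 ℂ)
  have h4 : tensorRank (kroneckerPow (cwTensor ℂ 2) 1) ≤ 4 := by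
    simpa using tensorRank_kroneckerPow_cwTensor_two_le_four_pow 1
  have hc : (5 - 1).choose 2 = 6 := by decide
  rw [hc] at hX
  have h265 := soloKos_cwTwoCube_koszulGen_ge
  have : m * (6 * tensorRank (kroneckerPow (cwTensor ℂ 2) 1)) ≤ 11 * (6 * 4) :=
    Nat.mul_le_mul hm (Nat.mul_le_mul_left 6 h4)
  omega

/-- **Window `(j, d) = (1, 2)` of the relative door needs `m ≥ 12`**: an identity
`⟨m⟩ ⊠ T^{⊠1} ⊵ T^{⊠2} ⊠ T^{⊠1}` for `T = T_cw,2` (which by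
`asymptoticRank_cwTensor_two_pow_le_of_relativeDegeneration` would give `R̃(T_cw,2)² ≤ m`) is impossible
for `m ≤ 11` — in particular the tight value `m = 9` (`R̃ = 3`) is not available in this format. [new] -/
theorem soloKos_cwTwo_relativeDoor_one_two {m : ℕ} (hm : m ≤ 11) :
    ¬ PolyDegeneratesTo (kroneckerTensor (unitTensor ℂ m) (kroneckerPow (cwTensor ℂ 2) 1))
        (kroneckerTensor (kroneckerPow (cwTensor ℂ 2) 2) (kroneckerPow (cwTensor ℂ 2) 1)) :=
  fun h => soloKos_cwTwo_cube_not_relDegeneration hm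
    (h.trans_restrictsTo (tensorMonRestrictsTo_kroneckerPow_add' (cwTensor ℂ 2) 2 1).tensorRestrictsTo)

end CwCube

end Summit.MatrixMultiplication.MatrixMultiplication.Theorems
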